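import Summits.AtomisticToContinuum.Crystallization.Theses.PalmUnimodularRigidity
import Summits.AtomisticToContinuum.Crystallization.Theorems.MinimiserShells.Negative.LoadBearing
import Summits.AtomisticToContinuum.Crystallization.Theorems.MinimiserShells.Negative.Rootedness
import Literature.Probability.Process.PointStationaryLaw
import Literature.MathematicalPhysics.StatisticalMechanics.RootEnergy
import Literature.MathematicalPhysics.StatisticalMechanics.MuGSC
import Summits.AtomisticToContinuum.Crystallization.Theorems.PalmUnimodularRigidityMinimiserShellsEnergyFloorDefs

/-!
# Energy floor `e_uni ≥ e*` (route item 9229 `UnimodularEnergyLowerBound`), part A: the phased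
# cubic grid — lemmas

Support file for stub `stub_energyFloor` (S2) of line `equilibrium-in-law-surgery` of crux
`MinimiserShells` (stmt-AtomisticToContinuum-9225), which discharges route item
stmt-AtomisticToContinuum-9229 `UnimodularEnergyLowerBound` ("e_uni ≥ e*": every point-stationary
hard-core probability law on rooted configurations of `ℝ³` has mean root energy `E_P[h] ≥ e*`).

GRID-PHASE machinery (definitions in `…EnergyFloorDefs`; public, meant to be reused by the surgery
stub S1):

* `cellIdx`: same cell iff equal indices; the SHIFT rule `cellIdx_sub` (translating the
  configuration by `-y` = shifting the phase by `L⁻¹ • y`), PERIODICITY in the phase under `ℤ³`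
  (`cellIdx_add_eq_iff`), boundedness of cells (`dist_lt_of_cellIdx_eq`), joint measurability, and
  `eventually_cellIdx_eq_zero` (a fixed point lies in the root's cell for all large `L`, for every
  phase in the open cube);
* the unit lattice `unitLattice = ℤ³ ⊂ ℝ³` and its fundamental domain `phaseDom = [0,1)³`, of
  positive finite volume; the PHASE-AVERAGE SHIFT LEMMA `setLIntegral_phaseDom_sub`:
  `∫_{[0,1)³} f (v - t) dv = ∫_{[0,1)³} f v dv` for every `ℤ³`-periodic measurable `f ≥ 0` (both
  `[0,1)³` and `[0,1)³ - t` are fundamental domains); and `phaseOut L z → 0` as `L → ∞`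
  (`tendsto_phaseOut`, dominated convergence on `[0,1)³`).
-/

noncomputable section

open MeasureTheory Filter
open scoped ENNReal BigOperators Topology Pointwise

namespace Summit.AtomisticToContinuum.Crystallization.Theorems.PalmUnimodularRigidityMinimiserShells.EnergyFloor

/-! ## Cells of the phased cubic grid -/

section Cells

variable {L : ℝ} {v z w y : EuclideanSpace ℝ (Fin 3)}

/-- Same cell, coordinatewise. -/
theorem cellIdx_eq_iff : cellIdx L v z = cellIdx L v w ↔ ∀ i, ⌊z i / L - v i⌋ = ⌊w i / L - v i⌋ :=
  funext_iff

/-- **SHIFT**: translating the point by `-y` is shifting the phase by `L⁻¹ • y`. -/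
theorem cellIdx_sub (hL : L ≠ 0) (v z y : EuclideanSpace ℝ (Fin 3)) :
    cellIdx L v (z - y) = cellIdx L (v + L⁻¹ • y) z := by
  funext i
  simp only [cellIdx, PiLp.sub_apply, PiLp.add_apply, PiLp.smul_apply, smul_eq_mul]
  congr 1
  field_simp
  ring

/-- **PERIODICITY**: an integer phase shift does not change the same-cell relation. -/
theorem cellIdx_add_eq_iff {k : EuclideanSpace ℝ (Fin 3)} (hk : ∀ i, ∃ m : ℤ, k i = m) :
    cellIdx L (v + k) z = cellIdx L (v + k) w ↔ cellIdx L v z = cellIdx L v w := by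
  rw [cellIdx_eq_iff, cellIdx_eq_iff]
  refine forall_congr' fun i => ?_
  obtain ⟨m, hm⟩ := hk i
  have h : ∀ x : EuclideanSpace ℝ (Fin 3), x i / L - (v + k) i = (x i / L - v i) - (m : ℝ) := by
    intro x
    simp only [PiLp.add_apply, hm]
    ring
  rw [h, h, Int.floor_sub_intCast, Int.floor_sub_intCast]
  exact ⟨fun h => by linarith, fun h => by rw [h]⟩

/-- The same, for integer phase shifts on the left. -/
theorem cellIdx_int_add_eq_iff {k : EuclideanSpace ℝ (Fin 3)} (hk : ∀ i, ∃ m : ℤ, k i = m) :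
    cellIdx L (k + v) z = cellIdx L (k + v) w ↔ cellIdx L v z = cellIdx L v w := by
  rw [add_comm]
  exact cellIdx_add_eq_iff hk

/-- Cells have side `L`: two points of one cell differ by `< L` in every coordinate. -/
theorem abs_sub_lt_of_cellIdx_eq (hL : 0 < L) (h : cellIdx L v z = cellIdx L v w) (i : Fin 3) :
    |z i - w i| < L := by
  have h1 := Int.abs_sub_lt_one_of_floor_eq_floor (cellIdx_eq_iff.1 h i)
  have h2 : z i / L - v i - (w i / L - v i) = (z i - w i) / L := by ring
  rw [h2, abs_div, abs_of_pos hL, div_lt_one hL] at h1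
  exact h1

/-- Cells are bounded: two points of one cell are at distance `< 2L`. -/
theorem dist_lt_of_cellIdx_eq (hL : 0 < L) (h : cellIdx L v z = cellIdx L v w) :
    dist z w < 2 * L := by
  rw [EuclideanSpace.dist_eq]
  have hle : ∑ i, dist (z i) (w i) ^ 2 ≤ ∑ _i : Fin 3, L ^ 2 := by
    refine Finset.sum_le_sum fun i _ => ?_
    rw [Real.dist_eq]
    exact pow_le_pow_left₀ (abs_nonneg _) (abs_sub_lt_of_cellIdx_eq hL h i).le 2
  rw [Finset.sum_const, Finset.card_univ, Fintype.card_fin, nsmul_eq_mul, Nat.cast_ofNat] at hle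
  calc Real.sqrt (∑ i, dist (z i) (w i) ^ 2) ≤ Real.sqrt (3 * L ^ 2) := Real.sqrt_le_sqrt hle
    _ < 2 * L := by
        rw [Real.sqrt_lt' (by positivity)]
        nlinarith

/-- A point of the root's cell has norm `< 2L`. -/
theorem norm_lt_of_cellIdx_eq_zero (hL : 0 < L) (h : cellIdx L v z = cellIdx L v 0) :
    ‖z‖ < 2 * L := by
  simpa using dist_lt_of_cellIdx_eq hL h

/-- The coordinate maps of `ℝ³` are measurable. -/
theorem measurable_coord (i : Fin 3) : Measurable fun z : EuclideanSpace ℝ (Fin 3) => z i :=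
  ((continuous_apply i).comp (PiLp.continuous_ofLp 2 _)).measurable

/-- Joint measurability of the same-cell relation in (phase, point), the second point fixed. -/
theorem measurableSet_cellIdx_eq (L : ℝ) (w : EuclideanSpace ℝ (Fin 3)) :
    MeasurableSet {p : EuclideanSpace ℝ (Fin 3) × EuclideanSpace ℝ (Fin 3) |
      cellIdx L p.1 p.2 = cellIdx L p.1 w} := by
  have h : {p : EuclideanSpace ℝ (Fin 3) × EuclideanSpace ℝ (Fin 3) |
      cellIdx L p.1 p.2 = cellIdx L p.1 w} =
      ⋂ i, {p | ⌊p.2 i / L - p.1 i⌋ = ⌊w i / L - p.1 i⌋} := by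
    ext p
    simp [cellIdx_eq_iff]
  rw [h]
  refine MeasurableSet.iInter fun i => measurableSet_eq_fun ?_ ?_
  · exact Int.measurable_floor.comp
      ((((measurable_coord i).comp measurable_snd).div_const L).sub
        ((measurable_coord i).comp measurable_fst))
  · exact Int.measurable_floor.comp
      (measurable_const.sub ((measurable_coord i).comp measurable_fst))

/-- Measurability of a cell (phase and second point fixed). -/
theorem measurableSet_setOf_cellIdx_eq (L : ℝ) (v w : EuclideanSpace ℝ (Fin 3)) :
    MeasurableSet {z : EuclideanSpace ℝ (Fin 3) | cellIdx L v z = cellIdx L v w} :=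
  measurable_prodMk_left (measurableSet_cellIdx_eq L w)

/-- Measurability in the phase of "`z` lies in the cell of `w`". -/
theorem measurableSet_setOf_cellIdx_eq_phase (L : ℝ) (z w : EuclideanSpace ℝ (Fin 3)) :
    MeasurableSet {v : EuclideanSpace ℝ (Fin 3) | cellIdx L v z = cellIdx L v w} :=
  measurable_prodMk_right (measurableSet_cellIdx_eq L w)

/-- Joint measurability of the same-cell relation in (point, phase), the second point fixed. -/
theorem measurableSet_cellIdx_eq_swap (L : ℝ) (w : EuclideanSpace ℝ (Fin 3)) :
    MeasurableSet {p : EuclideanSpace ℝ (Fin 3) × EuclideanSpace ℝ (Fin 3) |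
      cellIdx L p.2 p.1 = cellIdx L p.2 w} :=
  (measurableSet_cellIdx_eq L w).preimage measurable_swap

/-- **Large cells swallow fixed points**: for a phase `v` in the OPEN unit cube and a fixed point
`z`, `z` lies in the root's cell for all large meshes `L`. -/
theorem eventually_cellIdx_eq_zero (hv : ∀ i, 0 < v i ∧ v i < 1) (z : EuclideanSpace ℝ (Fin 3)) :
    ∀ᶠ L : ℝ in atTop, cellIdx L v z = cellIdx L v 0 := by
  have h : ∀ i, ∀ᶠ L : ℝ in atTop,
      ⌊z i / L - v i⌋ = ⌊(0 : EuclideanSpace ℝ (Fin 3)) i / L - v i⌋ := by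
    intro i
    obtain ⟨h0, h1⟩ := hv i
    have hε : 0 < min (v i) (1 - v i) := lt_min h0 (by linarith)
    have ht : Tendsto (fun L : ℝ => z i / L) atTop (𝓝 0) :=
      tendsto_const_nhds.div_atTop tendsto_id
    filter_upwards [ht.eventually (Metric.ball_mem_nhds (0 : ℝ) hε)] with L hL
    rw [Real.dist_eq, sub_zero, abs_lt, lt_min_iff] at hL
    have hm : -min (v i) (1 - v i) < z i / L := hL.1
    rw [PiLp.zero_apply, zero_div, zero_sub]
    have hr : ⌊-v i⌋ = -1 := by
      rw [Int.floor_eq_iff]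
      push_cast
      exact ⟨by linarith, by linarith⟩
    rw [hr, Int.floor_eq_iff]
    push_cast
    constructor
    · nlinarith [min_le_left (v i) (1 - v i), min_le_right (v i) (1 - v i)]
    · nlinarith [min_le_left (v i) (1 - v i), min_le_right (v i) (1 - v i)]
  exact (eventually_all.2 h).mono fun L hL => funext fun i => hL i

end Cells

/-! ## The unit lattice `ℤ³`, its fundamental domain `[0,1)³`, and phase averages -/

section Lattice

/-- Coordinates in the standard basis are the coordinates. -/
@[simp] theorem stdBasis_repr (x : EuclideanSpace ℝ (Fin 3)) (i : Fin 3) :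
    stdBasis.repr x i = x i := by
  simp [stdBasis]

/-- Lattice vectors have integer coordinates. -/
theorem exists_int_of_mem_unitLattice {k : EuclideanSpace ℝ (Fin 3)} (hk : k ∈ unitLattice)
    (i : Fin 3) : ∃ m : ℤ, k i = m := by
  obtain ⟨m, hm⟩ := (stdBasis.mem_span_iff_repr_mem ℤ k).1 hk i
  refine ⟨m, ?_⟩
  rw [← stdBasis_repr, ← hm]
  simp

/-- Membership in the phase domain. -/
theorem mem_phaseDom {v : EuclideanSpace ℝ (Fin 3)} : v ∈ phaseDom ↔ ∀ i, 0 ≤ v i ∧ v i < 1 := by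
  simp [phaseDom, ZSpan.mem_fundamentalDomain]

/-- The phase domain is measurable. -/
theorem measurableSet_phaseDom : MeasurableSet phaseDom :=
  ZSpan.fundamentalDomain_measurableSet _

/-- The phase domain has positive volume. -/
theorem volume_phaseDom_ne_zero : volume phaseDom ≠ 0 :=
  ZSpan.measure_fundamentalDomain_ne_zero _

/-- The phase domain has finite volume. -/
theorem volume_phaseDom_ne_top : volume phaseDom ≠ ∞ :=
  (ZSpan.fundamentalDomain_isBounded stdBasis).measure_lt_top.ne

/-- `[0,1)³` is a fundamental domain for `ℤ³` acting on `ℝ³` by translations. -/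
theorem isAddFundamentalDomain_phaseDom :
    IsAddFundamentalDomain unitLattice phaseDom (volume : Measure (EuclideanSpace ℝ (Fin 3))) :=
  ZSpan.isAddFundamentalDomain' stdBasis volume

/-- **Phase-average shift lemma**: the average over the phase cube of a `ℤ³`-periodic function is
translation invariant, `∫_{[0,1)³} f (v - t) dv = ∫_{[0,1)³} f v dv`. -/
theorem setLIntegral_phaseDom_sub {f : EuclideanSpace ℝ (Fin 3) → ℝ≥0∞} (hf : Measurable f)
    (hper : ∀ k : EuclideanSpace ℝ (Fin 3), (∀ i, ∃ m : ℤ, k i = m) → ∀ x, f (k + x) = f x)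
    (t : EuclideanSpace ℝ (Fin 3)) :
    ∫⁻ v in phaseDom, f (v - t) = ∫⁻ v in phaseDom, f v := by
  have hD := isAddFundamentalDomain_phaseDom
  have hDt : IsAddFundamentalDomain unitLattice ((-t) +ᵥ phaseDom)
      (volume : Measure (EuclideanSpace ℝ (Fin 3))) := hD.vadd_of_comm (-t)
  have hinv : ∀ (g : unitLattice) (x : EuclideanSpace ℝ (Fin 3)), f (g +ᵥ x) = f x :=
    fun g x => hper g (exists_int_of_mem_unitLattice g.2) x
  have hmeas : MeasurableSet ((-t) +ᵥ phaseDom) := measurableSet_phaseDom.const_vadd (-t)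
  have hpre : (fun v : EuclideanSpace ℝ (Fin 3) => v - t) ⁻¹' ((-t) +ᵥ phaseDom) = phaseDom := by
    ext v
    rw [Set.mem_preimage, Set.mem_vadd_set_iff_neg_vadd_mem, neg_neg, vadd_eq_add,
      add_sub_cancel]
  have hmap : (volume : Measure (EuclideanSpace ℝ (Fin 3))).map (fun v => v - t) = volume := by
    simp_rw [sub_eq_add_neg]
    exact map_add_right_eq_self volume (-t)
  calc ∫⁻ v in phaseDom, f (v - t)
      = ∫⁻ v in (fun v => v - t) ⁻¹' ((-t) +ᵥ phaseDom), f (v - t) := by rw [hpre]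
    _ = ∫⁻ w in (-t) +ᵥ phaseDom, f w ∂(volume.map fun v => v - t) :=
        (setLIntegral_map hmeas hf (measurable_sub_const t)).symm
    _ = ∫⁻ w in (-t) +ᵥ phaseDom, f w := by rw [hmap]
    _ = ∫⁻ v in phaseDom, f v := hDt.setLIntegral_eq hD f hinv

/-- Coordinate hyperplanes are Lebesgue-null. -/
theorem volume_setOf_coord_eq_zero (i : Fin 3) :
    volume {v : EuclideanSpace ℝ (Fin 3) | v i = 0} = 0 := by
  have h : {v : EuclideanSpace ℝ (Fin 3) | v i = 0} =
      (LinearMap.ker (EuclideanSpace.proj i : EuclideanSpace ℝ (Fin 3) →L[ℝ] ℝ).toLinearMap :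
        Submodule ℝ (EuclideanSpace ℝ (Fin 3))) := by
    ext v
    simp
  rw [h]
  refine Measure.addHaar_submodule volume _ fun htop => ?_
  have hmem : EuclideanSpace.single i (1 : ℝ) ∈
      LinearMap.ker (EuclideanSpace.proj i : EuclideanSpace ℝ (Fin 3) →L[ℝ] ℝ).toLinearMap := by
    rw [htop]; exact Submodule.mem_top
  simp at hmem

/-- Almost every phase of `[0,1)³` lies in the open cube `(0,1)³`. -/
theorem ae_restrict_phaseDom_pos :
    ∀ᵐ v ∂((volume : Measure (EuclideanSpace ℝ (Fin 3))).restrict phaseDom),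
      ∀ i, 0 < v i ∧ v i < 1 := by
  have h1 : ∀ᵐ v ∂((volume : Measure (EuclideanSpace ℝ (Fin 3))).restrict phaseDom),
      v ∈ phaseDom := ae_restrict_mem measurableSet_phaseDom
  have h2 : ∀ᵐ v ∂(volume : Measure (EuclideanSpace ℝ (Fin 3))), ∀ i, v i ≠ 0 := by
    rw [ae_all_iff]
    intro i
    rw [ae_iff]
    simpa using volume_setOf_coord_eq_zero i
  filter_upwards [h1, ae_restrict_of_ae h2] with v hv hv0
  rw [mem_phaseDom] at hv
  exact fun i => ⟨lt_of_le_of_ne (hv i).1 (hv0 i).symm, (hv i).2⟩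

/-- `phaseOut L` is measurable in the point. -/
theorem measurable_phaseOut (L : ℝ) : Measurable (phaseOut L) := by
  unfold phaseOut
  exact measurable_measure_prodMk_left
    (ν := (volume : Measure (EuclideanSpace ℝ (Fin 3))).restrict phaseDom)
    (measurableSet_cellIdx_eq_swap L 0).compl

/-- `phaseOut L z ≤ vol [0,1)³`. -/
theorem phaseOut_le (L : ℝ) (z : EuclideanSpace ℝ (Fin 3)) : phaseOut L z ≤ volume phaseDom := by
  unfold phaseOut
  calc _ ≤ (volume : Measure (EuclideanSpace ℝ (Fin 3))).restrict phaseDom Set.univ :=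
        measure_mono (Set.subset_univ _)
    _ = volume phaseDom := Measure.restrict_apply_univ _

/-- **`phaseOut L z → 0` as `L → ∞`** (along any sequence of meshes tending to infinity): for almost
every phase the fixed point `z` is eventually in the root's cell; dominated convergence on `[0,1)³`. -/
theorem tendsto_phaseOut {Ls : ℕ → ℝ} (hL : Tendsto Ls atTop atTop) (z : EuclideanSpace ℝ (Fin 3)) :
    Tendsto (fun n => phaseOut (Ls n) z) atTop (𝓝 0) := by
  set F : ℕ → EuclideanSpace ℝ (Fin 3) → ℝ≥0∞ :=
    fun n => {v | cellIdx (Ls n) v z ≠ cellIdx (Ls n) v 0}.indicator 1 with hF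
  have hS : ∀ n, MeasurableSet {v : EuclideanSpace ℝ (Fin 3) | cellIdx (Ls n) v z ≠ cellIdx (Ls n) v 0} :=
    fun n => (measurableSet_setOf_cellIdx_eq_phase (Ls n) z 0).compl
  have hFn : ∀ n, phaseOut (Ls n) z =
      ∫⁻ v in phaseDom, F n v ∂(volume : Measure (EuclideanSpace ℝ (Fin 3))) := fun n => by
    rw [hF, lintegral_indicator_one (hS n)]
    rfl
  simp_rw [hFn]
  have hlim : ∫⁻ _v in phaseDom, (0 : ℝ≥0∞) ∂(volume : Measure (EuclideanSpace ℝ (Fin 3))) = 0 :=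
    lintegral_zero
  rw [← hlim]
  refine tendsto_lintegral_of_dominated_convergence (fun _ => 1) (fun n => measurable_one.indicator (hS n))
    (fun n => Eventually.of_forall fun v => Set.indicator_le_self _ _ v) ?_ ?_
  · rw [lintegral_one, Measure.restrict_apply MeasurableSet.univ, Set.univ_inter]
    exact volume_phaseDom_ne_top
  · filter_upwards [ae_restrict_phaseDom_pos] with v hv
    have hev : ∀ᶠ n in atTop, F n v = 0 := by
      filter_upwards [hL.eventually (eventually_cellIdx_eq_zero hv z)] with n hn
      exact Set.indicator_of_notMem (fun h : cellIdx (Ls n) v z ≠ cellIdx (Ls n) v 0 => h hn) _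
    exact tendsto_const_nhds.congr' (hev.mono fun n hn => hn.symm)

end Lattice

end Summit.AtomisticToContinuum.Crystallization.Theorems.PalmUnimodularRigidityMinimiserShells.EnergyFloor

end
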